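import Literature.NumberTheory.GaloisRepresentations.LocalDualityTwoZero
import Literature.NumberTheory.GaloisRepresentations.LocalEulerCharacteristicMu
import Literature.NumberTheory.GaloisRepresentations.LocalFieldFiniteExtension
import Literature.NumberTheory.GaloisRepresentations.LocalFieldPadicProofs
import Literature.AnabelianGeometry.EtaleTheta.CyclotomeGaloisFixedPoints
import HarnessLib

/-!
# [AbsTopI] Thm 2.6 (iii), input "`δ²_l(G) = 0` [NSW 7.2.6]" at the finite levels: a uniform exponent kills `H²(G_k, ℤ/lⁱ)`

S. Mochizuki, *Topics in Absolute Anabelian Geometry I: Generalities* (2012) [AbsTopI], proof of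
Thm 2.6 (iii), p. 23: "Since `G` is of cohomological dimension `2` [...], and `δ²_l(G) = 0` for all
`l ∈ Primes` [cf., e.g., [NSW], Theorem 7.2.6], the spectral sequence yields an equality
`δ²_l(Π) = 0` if `l ∉ Σ`".  The classical input `δ²_l(G_k) = 0` (`k` an MLF) rests, through local Tate
duality, on the finiteness of the roots of unity of a `p`-adic field: `H²(G_k, ℤ/lⁱ)` is dual to
`μ_{lⁱ}(k)`, whose order is bounded independently of `i`.

This proof-only file supplies exactly that finite-level statement, from tree theorems:

* `natCard_invariants_homRep_trivial_le` — for the trivial module `ℤ/n` over any field `F` of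
  characteristic `0`, `#Hom_{Γ_F}(ℤ/n, μ_n) ≤ #μ_n(F)` (evaluation at `1`);
* `natCard_rootsOfUnity_le_of_exponent` — if every element of finite order of `F` is killed by `M`,
  then `#μ_n(F) ≤ M` for every `n ≥ 1`;
* `exists_nsmul_continuousCohomology_two_zmod_eq_zero` — **for a finite extension `K` of `ℚ_p`
  and any prime `l` there is ONE `m ≥ 1` with `m · H²(G_K, ℤ/lⁱ) = 0` for all `i`** (local duality
  in bidegree `(2,0)`, the tree's `natCard_two_eq_natCard_invariants_homRep`, at the tree's valued
  model of `K`; the uniform exponent of the roots of unity of `K`, the tree's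
  `exists_exponent_rootsOfUnity_of_finiteDimensional`; `m = M!`).

Combined with `PadicCoefficientsTowerTorsion.lean` this gives `H²_cont(G_K, ℚ_l) = 0`, i.e.
`δ²_l(G_K) = 0`, once `H¹(G_K, ℤ/lⁱ)` is known to be finite.  Classical, undisputed; nothing here
bears on [IUTchIII] Cor. 3.12.

## References
* S. Mochizuki, *Topics in Absolute Anabelian Geometry I* (2012), Thm 2.6 (iii), proof p. 23.
  [MochizukiAbsTopI2012]
* J. Neukirch, A. Schmidt, K. Wingberg, *Cohomology of Number Fields* (2008), Thm. 7.2.6.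
  [NeukirchSchmidtWingberg2008]
* J.-P. Serre, *Galois Cohomology* (1997), II §5.2 Thm. 2. [SerreGaloisCohomology1997]
-/

noncomputable section

open CategoryTheory Function Topology

namespace Literature.AnabelianGeometry.AbsoluteAnabelian

open Literature.NumberTheory.GaloisRepresentations
open _root_.TopRep _root_.ContRepresentation _root_.ContinuousCohomology Field DiscreteGaloisModule

/-! ### Invariant homomorphisms `ℤ/n → μ_n` and roots of unity -/

section Invariants

variable (F : Type) [Field F] [CharZero F] (n : ℕ) [NeZero n]

/-- **`#Hom_{Γ_F}(ℤ/n, μ_n) ≤ #μ_n(F̄)^{Γ_F}`**: a `Γ_F`-invariant homomorphism from the TRIVIAL module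
`ℤ/n` to `μ_n = μ_n(F̄)` is determined by its value at `1`, which is a `Γ_F`-fixed root of unity.
[cite: SerreGaloisCohomology1997, II §5.2 Thm. 2] -/
theorem natCard_invariants_homRep_trivial_le :
    Nat.card ((ContinuousRep.trivial (absoluteGaloisGroup F) ℤ (ZMod n)).homRep
        (mu F n)).toTopRep.ρ.invariants ≤
      Nat.card (mu F n).toTopRep.ρ.invariants := by
  classical
  haveI : Finite (MuCarrier F n) := finite_muCarrier (F := F) (n := n)
  haveI : Finite (mu F n).toTopRep.ρ.invariants := inferInstance
  refine Nat.card_le_card_of_injective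
    (fun f => (⟨f.1 (1 : ZMod n), fun σ => ?_⟩ : (mu F n).toTopRep.ρ.invariants)) ?_
  · -- invariance of `f 1`
    have hf := (ContinuousRep.homRep_apply_eq_self_iff _ _ σ f.1).1 (f.2 σ) 1
    rw [ContinuousRep.trivial_apply] at hf
    exact hf
  · intro f g h
    have h1 : f.1 (1 : ZMod n) = g.1 (1 : ZMod n) := congrArg Subtype.val h
    apply Subtype.ext
    refine HomCarrier.ext fun m => ?_
    have hm : m = m.val • (1 : ZMod n) := by rw [Nat.smul_one_eq_cast, ZMod.natCast_zmod_val]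
    rw [hm, map_nsmul, map_nsmul, h1]

omit [CharZero F] in
/-- If every element of finite (multiplicative) order of the field `F` is killed by the exponent `M`,
then `#μ_n(F) ≤ M` for every `n ≥ 1` (`μ_n(F) ⊆ μ_M(F)`, at most `M` roots of `X^M - 1`).
[cite: NeukirchSchmidtWingberg2008, Thm. 7.2.6] -/
theorem natCard_rootsOfUnity_le_of_exponent {M : ℕ} (hM0 : 0 < M)
    (hM : ∀ x : F, IsOfFinOrder x → x ^ M = 1) : Nat.card (rootsOfUnity n F) ≤ M := by
  haveI : NeZero M := ⟨hM0.ne'⟩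
  have hle : rootsOfUnity n F ≤ rootsOfUnity M F := by
    intro ζ hζ
    rw [mem_rootsOfUnity] at hζ ⊢
    have hfin : IsOfFinOrder ((ζ : Fˣ) : F) := by
      refine isOfFinOrder_iff_pow_eq_one.2 ⟨n, Nat.pos_of_ne_zero (NeZero.ne n), ?_⟩
      rw [← Units.val_pow_eq_pow_val, hζ, Units.val_one]
    have h := hM _ hfin
    rw [← Units.val_pow_eq_pow_val, ← Units.val_one] at h
    exact Units.ext h
  exact (Nat.card_le_card_of_injective _ (Subgroup.inclusion_injective hle)).trans
    (card_rootsOfUnity (k := M) (R := F))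

end Invariants

/-! ### A uniform exponent for `H²(G_K, ℤ/lⁱ)`, `K/ℚ_p` finite -/

/-- **A uniform exponent kills `H²(G_K, ℤ/lⁱ)` for all `i`** (`K` a finite extension of `ℚ_p`, `l`
any prime, trivial action): by local Tate duality in bidegree `(2,0)`, `#H²(G_K, ℤ/lⁱ) =
#Hom_{G_K}(ℤ/lⁱ, μ_{lⁱ}) ≤ #μ_{lⁱ}(K) ≤ M`, where `M` is a uniform exponent of the roots of unity of
the `p`-adic field `K`; hence `M! · H²(G_K, ℤ/lⁱ) = 0`.  This is the finite-level content of
"`δ²_l(G) = 0` [NSW, Thm. 7.2.6]" in the proof of [AbsTopI] Thm 2.6 (iii).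
[cite: MochizukiAbsTopI2012, Thm 2.6 (iii) proof p.23] [cite: NeukirchSchmidtWingberg2008, Thm. 7.2.6] -/
theorem exists_nsmul_continuousCohomology_two_zmod_eq_zero (p : ℕ) [Fact p.Prime]
    (K : Type) [Field K] [Algebra ℚ_[p] K] [FiniteDimensional ℚ_[p] K] (l : ℕ) [Fact l.Prime] :
    ∃ m : ℕ, 0 < m ∧ ∀ (i : ℕ) (x : continuousCohomology 2
      (ContinuousRep.trivial (absoluteGaloisGroup K) ℤ (ZMod (l ^ i))).toTopRep), m • x = 0 := by
  obtain ⟨M, hM0, hM⟩ :=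
    Literature.AnabelianGeometry.EtaleTheta.exists_exponent_rootsOfUnity_of_finiteDimensional
      (p := p) K
  refine ⟨M.factorial, Nat.factorial_pos M, fun i x => ?_⟩
  -- the tree's valued model of `K` as a non-archimedean local field of characteristic `0`
  haveI : IsNonarchimedeanLocalField ℚ_[p] := Padic.isNonarchimedeanLocalField_holds p
  letI := FiniteExtension.valuativeRel ℚ_[p] K
  letI := FiniteExtension.topologicalSpace ℚ_[p] K
  haveI : IsNonarchimedeanLocalField K := FiniteExtension.isNonarchimedeanLocalField ℚ_[p] K
  haveI : CharZero K := charZero_of_injective_algebraMap (algebraMap ℚ_[p] K).injective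
  haveI : NeZero (l ^ i) := ⟨pow_ne_zero i (Fact.out : l.Prime).ne_zero⟩
  set ρ := ContinuousRep.trivial (absoluteGaloisGroup K) ℤ (ZMod (l ^ i)) with hρ
  have hli : ∀ m : ZMod (l ^ i), l ^ i • m = 0 := fun m => by
    rw [nsmul_eq_mul, ZMod.natCast_self, zero_mul]
  obtain ⟨hfin, hcard⟩ := natCard_two_eq_natCard_invariants_homRep (F := K) ρ hli
  haveI := hfin
  -- `#H²(G_K, ℤ/lⁱ) ≤ M`
  have hle : Nat.card (continuousCohomology 2 ρ.toTopRep) ≤ M := by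
    rw [hcard]
    exact (natCard_invariants_homRep_trivial_le K (l ^ i)).trans
      ((natCard_invariants_mu K (l ^ i)).le.trans (natCard_rootsOfUnity_le_of_exponent K (l ^ i) hM0 hM))
  have hdvd : Nat.card (continuousCohomology 2 ρ.toTopRep) ∣ M.factorial :=
    Nat.dvd_factorial Nat.card_pos hle
  obtain ⟨k, hk⟩ := hdvd
  rw [hk, mul_comm, mul_nsmul, card_nsmul_eq_zero']

end Literature.AnabelianGeometry.AbsoluteAnabelian

end
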